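import Mathlib.Analysis.InnerProductSpace.LinearPMap
import Mathlib.Analysis.InnerProductSpace.Projection.Submodule
import Mathlib.LinearAlgebra.FiniteDimensional.Lemmas
import Mathlib.Tactic.Module
import Literature.Analysis.UnboundedOperators.SymmetricPMap
import Literature.Analysis.UnboundedOperators.SelfAdjointResolvent
import HarnessLib

/-!
# Von Neumann's first formula: `dom T† = dom T̄ ∔ 𝒩₊ ∔ 𝒩₋` for a symmetric operator

Library file (topic `Literature/Analysis/UnboundedOperators`; theorems only, no definition, no named
fact), continuing `SelfAdjointResolvent.lean` (which treats the SELF-ADJOINT case `𝒩± = 0`) and the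
vocabulary of `SymmetricPMap.lean` (`LinearPMap.IsSymmetric`, `LinearPMap.eigenspace`).

Source followed: D. E. Edmunds, W. D. Evans, *Spectral Theory and Differential Operators*, 2nd ed.,
Oxford Math. Monographs (2018), Chapter III §4 "Symmetric and self-adjoint operators" (held copy
pdf pp. 120–124, read): the **deficiency subspaces** `𝒩± := 𝒩(T* ∓ iI) = ℛ(T ± iI)^⊥` (III (4.5))
of a closed symmetric densely defined `T`, and **Theorem III.4.5** (von Neumann):
`𝒟(T*) = 𝒟(T) ∔ 𝒩₊ ∔ 𝒩₋` (III (4.6)) with `dim 𝒟(T*)/𝒟(T) = m₊(T) + m₋(T)` (III (4.7)).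
(Same statements: Reed–Simon II §X.1; Edmunds–Evans prove (4.6) as an orthogonal sum for the graph
inner product of `T*` — here we record the DIRECT sum, which is what (4.7) and the applications use.)

**Contents** (`T : H →ₗ.[ℂ] H` on a complex Hilbert space; `T†` = Mathlib's `LinearPMap.adjoint`;
`𝒩₊ = T†.eigenspace I`, `𝒩₋ = T†.eigenspace (-I)` with the tree's `LinearPMap.eigenspace`; `T − z`
on `dom T` is `subSMul T z` of `SelfAdjointResolvent.lean`):
* symmetric versions of the bounded-below lemmas: `norm_subSMul_sq_of_isSymmetric`
  (`‖(T − z)x‖² = ‖(T − Re z)x‖² + (Im z)²‖x‖²`), `subSMul_injective_of_isSymmetric`,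
  `isClosed_range_subSMul_of_isSymmetric` (closed symmetric ⇒ `ℛ(T − z)` closed, `Im z ≠ 0`);
* (4.5): `orthogonal_range_subSMul_eq_eigenspace` — `ℛ(T − z̄)^⊥ = 𝒩(T† − z)` for ANY densely defined
  `T` and any `z`; `orthogonal_range_add_I_eq` / `orthogonal_range_sub_I_eq` (`𝒩± = ℛ(T ± i)^⊥`);
  `exists_range_add_deficiency` (`H = ℛ(T + i) ⊕ 𝒩₊`);
* Theorem III.4.5: `exists_vonNeumann_decomposition` (existence of `x = x₀ + x₊ + x₋`),
  `vonNeumann_decomposition_unique` (directness; closedness not needed), `adjoint_domain_eq_sup`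
  ((4.6) as an identity of submodules), `nonempty_deficiency_prod_equiv_quotient`
  (`𝒩₊ × 𝒩₋ ≃ₗ dom T†/dom T`), `finrank_adjoint_domain_quotient` ((4.7)),
  `finiteDimensional_adjoint_domain_quotient`;
* the form for an operator given on a core: `adjoint_le_adjoint_of_le`, `isClosable_of_isSymmetric`,
  `closure_le_adjoint`, `adjoint_closure` (`T̄† = T†`), `isSymmetric_closure`, and then
  `adjoint_domain_eq_closure_domain_sup` / `vonNeumann_decomposition_unique_closure` /
  `finrank_adjoint_domain_quotient_closure` (`dom T† = dom T̄ ∔ 𝒩₊ ∔ 𝒩₋`,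
  `dim dom T†/dom T̄ = m₊ + m₋`) — e.g. `T` = a differential expression on `C_c^∞`, `T̄ = T_min`,
  `T† = T_max` (Connes–Moscovici 2022 Lemma 1.1/1.5: `W_min`, `W_max`, deficiency indices `(4,4)`,
  `dim dom W_max / dom W_min = 8`).

## References
* D. E. Edmunds, W. D. Evans, *Spectral Theory and Differential Operators*, 2nd ed., Oxford (2018),
  Ch. III §4, eq. (4.5), Thm 4.5 (4.6)–(4.7) (held copy pdf p0122–p0124). [EdmundsEvans2018]
* M. Reed, B. Simon, *Methods of Modern Mathematical Physics I*, rev. ed. (1980), §VIII.2 (symmetric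
  operators, Thm VIII.3 proof: `‖(A ∓ i)φ‖² = ‖Aφ‖² + ‖φ‖²`). [ReedSimonI1980]
-/

noncomputable section

open _root_.LinearPMap _root_.Filter _root_.Topology Complex
open scoped InnerProductSpace ComplexConjugate

namespace Literature.Analysis.UnboundedOperators

variable {H : Type*} [NormedAddCommGroup H] [InnerProductSpace ℂ H] [CompleteSpace H]
variable {T : H →ₗ.[ℂ] H}

/-! ### Symmetric operators: `T ± i` bounded below, injective, closed range -/

omit [CompleteSpace H] in
/-- For symmetric `T`: `⟪T x, x⟫` is real. [cite: ReedSimonI1980, §VIII.2 (symmetric operators; Thm VIII.3 proof)] -/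
theorem im_inner_map_self_eq_zero_of_isSymmetric (hT : T.IsSymmetric) (x : T.domain) :
    (⟪(T x : H), (x : H)⟫_ℂ).im = 0 := by
  have h : ⟪(T x : H), (x : H)⟫_ℂ = ⟪(x : H), (T x : H)⟫_ℂ := hT x x
  rw [h]
  have := hT.im_inner_self_eq_zero x
  simpa using this

omit [CompleteSpace H] in
/-- For symmetric `T` and `z = a + ib`: `‖T x − z x‖² = ‖T x − a x‖² + b² ‖x‖²`.
[cite: ReedSimonI1980, Thm VIII.3 (proof: `‖(A ∓ i)φ‖² = ‖Aφ‖² + ‖φ‖²`)] -/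
theorem norm_subSMul_sq_of_isSymmetric (hT : T.IsSymmetric) (z : ℂ) (x : T.domain) :
    ‖subSMul T z x‖ ^ 2 = ‖subSMul T (z.re : ℂ) x‖ ^ 2 + z.im ^ 2 * ‖(x : H)‖ ^ 2 := by
  rw [subSMul_apply, subSMul_apply]
  set a : H := (T x : H) - (z.re : ℂ) • (x : H) with ha
  set b : H := ((z.im : ℂ) * Complex.I) • (x : H) with hb
  have hsplit : (T x : H) - z • (x : H) = a - b := by
    rw [ha, hb]
    have hz : z = (z.re : ℂ) + (z.im : ℂ) * Complex.I := (Complex.re_add_im z).symm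
    conv_lhs => rw [hz]
    rw [add_smul]; abel
  have hre : RCLike.re ⟪a, b⟫_ℂ = 0 := by
    rw [ha, hb, inner_smul_right, inner_sub_left, inner_smul_left]
    have h1 : (⟪(T x : H), (x : H)⟫_ℂ).im = 0 := im_inner_map_self_eq_zero_of_isSymmetric hT x
    have h2 : (⟪(x : H), (x : H)⟫_ℂ).im = 0 := by
      simpa using inner_self_im (𝕜 := ℂ) (x : H)
    set p : ℂ := ⟪(T x : H), (x : H)⟫_ℂ with hp
    set q : ℂ := ⟪(x : H), (x : H)⟫_ℂ with hq
    have hp' : p = (p.re : ℂ) := by rw [Complex.ext_iff]; simp [h1]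
    have hq' : q = (q.re : ℂ) := by rw [Complex.ext_iff]; simp [h2]
    rw [hp', hq']
    simp [Complex.mul_re, Complex.mul_im]
  have hnb : ‖b‖ ^ 2 = z.im ^ 2 * ‖(x : H)‖ ^ 2 := by
    rw [hb, norm_smul, mul_pow]
    simp [Complex.norm_I]
  rw [hsplit, @norm_sub_sq ℂ, hre, hnb]
  ring

omit [CompleteSpace H] in
/-- `|Im z| ‖x‖ ≤ ‖T x − z x‖` for symmetric `T`. [cite: ReedSimonI1980, Thm VIII.3 (proof)] -/
theorem abs_im_mul_norm_le_of_isSymmetric (hT : T.IsSymmetric) (z : ℂ) (x : T.domain) :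
    |z.im| * ‖(x : H)‖ ≤ ‖subSMul T z x‖ := by
  have h := norm_subSMul_sq_of_isSymmetric hT z x
  have h1 : (|z.im| * ‖(x : H)‖) ^ 2 ≤ ‖subSMul T z x‖ ^ 2 := by
    rw [h, mul_pow, sq_abs]
    nlinarith [sq_nonneg ‖subSMul T (z.re : ℂ) x‖]
  exact (pow_le_pow_iff_left₀ (by positivity) (norm_nonneg _) two_ne_zero).1 h1

omit [CompleteSpace H] in
/-- `T − z` is injective on `dom T` for symmetric `T` and `Im z ≠ 0` (so `def(T − zI) = 0` off the
real axis). [cite: EdmundsEvans2018, Ch. III §4 eq. (4.5) (discussion)] -/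
theorem subSMul_injective_of_isSymmetric (hT : T.IsSymmetric) {z : ℂ} (hz : z.im ≠ 0) :
    Function.Injective (subSMul T z) := by
  rw [← LinearMap.ker_eq_bot, LinearMap.ker_eq_bot']
  intro x hx
  have h := abs_im_mul_norm_le_of_isSymmetric hT z x
  rw [hx, norm_zero] at h
  have hx0 : ‖(x : H)‖ = 0 := by
    have : 0 < |z.im| := abs_pos.2 hz
    nlinarith [norm_nonneg (x : H)]
  exact Subtype.ext (norm_eq_zero.1 hx0)

/-- The range of `T − z` is closed for a CLOSED symmetric `T` and `Im z ≠ 0` (closed operator bounded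
below). [cite: EdmundsEvans2018, Ch. III §4 eq. (4.5) (`𝒩±` closed, `ℛ(T ± i)` closed)] -/
theorem isClosed_range_subSMul_of_isSymmetric (hT : T.IsSymmetric) (hc : T.IsClosed) {z : ℂ}
    (hz : z.im ≠ 0) : IsClosed (LinearMap.range (subSMul T z) : Set H) := by
  refine IsSeqClosed.isClosed ?_
  intro u y hu huy
  choose x hx using fun n => (LinearMap.mem_range.1 (hu n))
  have hb : 0 < |z.im| := abs_pos.2 hz
  have hlip : ∀ n m, ‖(x n : H) - (x m : H)‖ ≤ |z.im|⁻¹ * ‖u n - u m‖ := by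
    intro n m
    have h := abs_im_mul_norm_le_of_isSymmetric hT z (x n - x m)
    rw [LinearMap.map_sub, hx n, hx m, Submodule.coe_sub] at h
    rw [le_inv_mul_iff₀' hb]; linarith
  have hcu : CauchySeq u := huy.cauchySeq
  have hcx : CauchySeq fun n => (x n : H) := by
    rw [Metric.cauchySeq_iff] at hcu ⊢
    intro ε hε
    obtain ⟨N, hN⟩ := hcu (|z.im| * ε) (by positivity)
    refine ⟨N, fun n hn m hm => ?_⟩
    rw [dist_eq_norm]
    calc ‖(x n : H) - (x m : H)‖ ≤ |z.im|⁻¹ * ‖u n - u m‖ := hlip n m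
      _ < |z.im|⁻¹ * (|z.im| * ε) := by
          gcongr; rw [← dist_eq_norm]; exact hN n hn m hm
      _ = ε := by field_simp
  obtain ⟨x₀, hx₀⟩ := cauchySeq_tendsto_of_complete hcx
  have hTx : Tendsto (fun n => (T (x n) : H)) atTop (𝓝 (y + z • x₀)) := by
    have : ∀ n, (T (x n) : H) = u n + z • (x n : H) := by
      intro n
      have := hx n
      rw [subSMul_apply] at this
      rw [← this]; abel
    simp_rw [this]
    exact huy.add (hx₀.const_smul z)
  have hmem : ∀ n, ((x n : H), (T (x n) : H)) ∈ (T.graph : Set (H × H)) := fun n =>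
    (LinearPMap.mem_graph_iff _).2 ⟨x n, rfl, rfl⟩
  have hlim : ((x₀, y + z • x₀) : H × H) ∈ (T.graph : Set (H × H)) :=
    hc.mem_of_tendsto (hx₀.prodMk_nhds hTx) (Eventually.of_forall hmem)
  rw [SetLike.mem_coe, LinearPMap.mem_graph_iff] at hlim
  obtain ⟨w, hw1, hw2⟩ := hlim
  simp only at hw1 hw2
  refine ⟨w, ?_⟩
  change (T w : H) - z • (w : H) = y
  rw [hw2, hw1]; abel

/-! ### Deficiency subspaces as orthogonal complements of ranges: `𝒩(T† − z) = Ran(T − z̄)ᗮ` -/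

/-- For a densely defined `T` and any `z`: `(Ran (T − z̄))ᗮ = ker (T† − z)` (the latter as the
`LinearPMap` eigenspace of `T†` at `z`). [cite: EdmundsEvans2018, Ch. III §4 eq. (4.5)] -/
theorem orthogonal_range_subSMul_eq_eigenspace (hd : Dense (T.domain : Set H)) (z : ℂ) :
    (LinearMap.range (subSMul T (conj z)))ᗮ = T†.eigenspace z := by
  ext y
  rw [Submodule.mem_orthogonal, LinearPMap.mem_eigenspace_iff]
  constructor
  · intro hy
    have hyx : ∀ x : T.domain, ⟪y, (T x : H)⟫_ℂ = ⟪z • y, (x : H)⟫_ℂ := by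
      intro x
      have h := hy (subSMul T (conj z) x) (LinearMap.mem_range_self _ _)
      rw [subSMul_apply, inner_sub_left, inner_smul_left, Complex.conj_conj, sub_eq_zero] at h
      -- h : ⟪T x, y⟫ = z * ⟪x, y⟫
      rw [← inner_conj_symm, h, map_mul, inner_conj_symm, inner_smul_left]
    have hydom : y ∈ T†.domain :=
      mem_adjoint_domain_of_exists y ⟨z • y, fun x => (hyx x).symm⟩
    exact ⟨hydom, adjoint_apply_eq hd ⟨y, hydom⟩ fun x => (hyx x).symm⟩
  · rintro ⟨hydom, hval⟩ u ⟨x, rfl⟩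
    rw [subSMul_apply, inner_sub_left, inner_smul_left, Complex.conj_conj, sub_eq_zero]
    have h1 : ⟪(T† ⟨y, hydom⟩ : H), (x : H)⟫_ℂ = ⟪y, (T x : H)⟫_ℂ :=
      adjoint_isFormalAdjoint hd ⟨y, hydom⟩ x
    rw [hval, inner_smul_left] at h1
    -- h1 : conj z * ⟪y, x⟫ = ⟪y, T x⟫
    rw [← inner_conj_symm (T x : H) y, ← h1, map_mul, Complex.conj_conj, inner_conj_symm]

/-- In particular `𝒩₊ := ker (T† − i) = Ran (T + i)ᗮ`. [cite: EdmundsEvans2018, Ch. III §4 eq. (4.5)] -/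
theorem orthogonal_range_add_I_eq (hd : Dense (T.domain : Set H)) :
    (LinearMap.range (subSMul T (-I)))ᗮ = T†.eigenspace I := by
  rw [← orthogonal_range_subSMul_eq_eigenspace hd I, Complex.conj_I]

/-- and `𝒩₋ := ker (T† + i) = Ran (T − i)ᗮ`. [cite: EdmundsEvans2018, Ch. III §4 eq. (4.5)] -/
theorem orthogonal_range_sub_I_eq (hd : Dense (T.domain : Set H)) :
    (LinearMap.range (subSMul T I))ᗮ = T†.eigenspace (-I) := by
  rw [← orthogonal_range_subSMul_eq_eigenspace hd (-I), _root_.map_neg, Complex.conj_I, neg_neg]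

/-- `H = Ran (T + i) ⊕ 𝒩₊` for a closed symmetric densely defined `T`: every `y` splits as
`y = (T x₀ + i x₀) + n` with `x₀ ∈ dom T`, `n ∈ 𝒩₊`. [cite: EdmundsEvans2018, Ch. III §4 eq. (4.5) with Thm 4.5 (proof)] -/
theorem exists_range_add_deficiency (hT : T.IsSymmetric) (hc : T.IsClosed)
    (hd : Dense (T.domain : Set H)) (y : H) :
    ∃ x₀ : T.domain, ∃ n ∈ T†.eigenspace I, y = subSMul T (-I) x₀ + n := by
  set K : Submodule ℂ H := LinearMap.range (subSMul T (-I)) with hK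
  have hKc : IsClosed (K : Set H) :=
    isClosed_range_subSMul_of_isSymmetric hT hc (by simp : (-I).im ≠ 0)
  haveI : CompleteSpace K := hKc.completeSpace_coe
  have htop : K ⊔ Kᗮ = ⊤ := Submodule.sup_orthogonal_of_hasOrthogonalProjection
  have hy : y ∈ K ⊔ Kᗮ := by rw [htop]; trivial
  obtain ⟨y₁, hy₁, n, hn, rfl⟩ := Submodule.mem_sup.1 hy
  obtain ⟨x₀, rfl⟩ := LinearMap.mem_range.1 hy₁
  refine ⟨x₀, n, ?_, rfl⟩
  rwa [hK, orthogonal_range_add_I_eq hd] at hn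

/-! ### Von Neumann's first formula -/

/-- A symmetric densely defined operator is extended by its adjoint: `T ⊂ T†` (Mathlib's
`IsFormalAdjoint.le_adjoint`). [cite: EdmundsEvans2018, Ch. III §4 ¶1 (`T ⊂ T*` for symmetric `T`)] -/
theorem le_adjoint_of_isSymmetric (hT : T.IsSymmetric) (hd : Dense (T.domain : Set H)) : T ≤ T† :=
  IsFormalAdjoint.le_adjoint hd hT

/-- On `𝒩(T† − z)`: `n ∈ dom T†` and `T† n = z n` (unpacking the tree's `LinearPMap.eigenspace`).
[cite: EdmundsEvans2018, Ch. III §4 eq. (4.5)] -/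
theorem adjoint_apply_of_mem_eigenspace {z : ℂ} {n : H} (hn : n ∈ T†.eigenspace z) :
    ∃ h : n ∈ T†.domain, (T† ⟨n, h⟩ : H) = z • n :=
  LinearPMap.mem_eigenspace_iff.1 hn

/-- **Von Neumann's decomposition, existence**: for a closed symmetric densely defined `T`, every
`x ∈ dom T†` is `x = x₀ + x₊ + x₋` with `x₀ ∈ dom T`, `x₊ ∈ 𝒩₊ = ker(T† − i)`, `x₋ ∈ 𝒩₋ = ker(T† + i)`.
[cite: EdmundsEvans2018, Ch. III §4 Thm 4.5 (4.6)] -/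
theorem exists_vonNeumann_decomposition (hT : T.IsSymmetric) (hc : T.IsClosed)
    (hd : Dense (T.domain : Set H)) {x : H} (hx : x ∈ T†.domain) :
    ∃ x₀ ∈ T.domain, ∃ xp ∈ T†.eigenspace I, ∃ xm ∈ T†.eigenspace (-I), x = x₀ + xp + xm := by
  have hle : T ≤ T† := le_adjoint_of_isSymmetric hT hd
  -- `y := T† x + i x = (T x₀ + i x₀) + n`, `n ∈ 𝒩₊`
  obtain ⟨x₀, n, hn, hy⟩ := exists_range_add_deficiency hT hc hd ((T† ⟨x, hx⟩ : H) + I • x)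
  obtain ⟨hnd, hnv⟩ := adjoint_apply_of_mem_eigenspace hn
  -- `xp := n / (2i)`
  set xp : H := (2 * I)⁻¹ • n with hxp
  have hxp_mem : xp ∈ T†.eigenspace I := Submodule.smul_mem _ _ hn
  have hx₀d : (x₀ : H) ∈ T†.domain := hle.1 x₀.2
  have hTx₀ : (T† ⟨x₀, hx₀d⟩ : H) = T x₀ := (hle.2 rfl).symm
  have hxpd : xp ∈ T†.domain := Submodule.smul_mem _ _ hnd
  have hTxp : (T† ⟨xp, hxpd⟩ : H) = I • xp := by
    have : (⟨xp, hxpd⟩ : T†.domain) = (2 * I)⁻¹ • (⟨n, hnd⟩ : T†.domain) := rfl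
    rw [this, LinearPMap.map_smul, hnv, hxp, smul_comm]
  set xm : H := x - x₀ - xp with hxm
  have hxmd : xm ∈ T†.domain := Submodule.sub_mem _ (Submodule.sub_mem _ hx hx₀d) hxpd
  refine ⟨x₀, x₀.2, xp, hxp_mem, xm, ?_, by rw [hxm]; abel⟩
  -- `xm ∈ 𝒩₋`: `T† xm + i xm = (T†x + ix) − (T x₀ + i x₀) − (i xp + i xp) = y − (y − n) − n = 0`
  rw [LinearPMap.mem_eigenspace_iff]
  refine ⟨hxmd, ?_⟩
  have hlin : (T† ⟨xm, hxmd⟩ : H) = (T† ⟨x, hx⟩ : H) - (T† ⟨x₀, hx₀d⟩ : H) - (T† ⟨xp, hxpd⟩ : H) := by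
    have e : (⟨xm, hxmd⟩ : T†.domain) = ⟨x, hx⟩ - ⟨x₀, hx₀d⟩ - ⟨xp, hxpd⟩ := rfl
    rw [e, LinearPMap.map_sub, LinearPMap.map_sub]
  rw [hlin, hTx₀, hTxp]
  have hn2 : n = (2 * I) • xp := by
    rw [hxp, smul_smul, mul_inv_cancel₀ (by norm_num : (2 : ℂ) * I ≠ 0), one_smul]
  rw [subSMul_apply, hn2] at hy
  rw [eq_sub_of_add_eq hy, hxm]
  module

/-- **Von Neumann's decomposition, uniqueness**: for a symmetric densely defined `T`, if
`x₀ + x₊ + x₋ = 0` with `x₀ ∈ dom T`, `x₊ ∈ 𝒩₊`, `x₋ ∈ 𝒩₋`, then all three vanish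
(closedness is not needed for this half). [cite: EdmundsEvans2018, Ch. III §4 Thm 4.5 (4.6)] -/
theorem vonNeumann_decomposition_unique (hT : T.IsSymmetric) (hd : Dense (T.domain : Set H))
    {x₀ xp xm : H} (h₀ : x₀ ∈ T.domain) (hp : xp ∈ T†.eigenspace I) (hm : xm ∈ T†.eigenspace (-I))
    (h : x₀ + xp + xm = 0) : x₀ = 0 ∧ xp = 0 ∧ xm = 0 := by
  have hle : T ≤ T† := le_adjoint_of_isSymmetric hT hd
  obtain ⟨hpd, hpv⟩ := adjoint_apply_of_mem_eigenspace hp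
  obtain ⟨hmd, hmv⟩ := adjoint_apply_of_mem_eigenspace hm
  have hx₀d : x₀ ∈ T†.domain := hle.1 h₀
  have hTx₀ : (T† ⟨x₀, hx₀d⟩ : H) = T ⟨x₀, h₀⟩ := (hle.2 rfl).symm
  -- apply `T† + i` to `x₀ + xp + xm = 0`
  have hsum_d : x₀ + xp + xm ∈ T†.domain := Submodule.add_mem _ (Submodule.add_mem _ hx₀d hpd) hmd
  have hzero : (T† ⟨x₀ + xp + xm, hsum_d⟩ : H) = 0 := by
    have : (⟨x₀ + xp + xm, hsum_d⟩ : T†.domain) = 0 := Subtype.ext h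
    rw [this, LinearPMap.map_zero]
  have hlin : (T† ⟨x₀ + xp + xm, hsum_d⟩ : H) =
      (T† ⟨x₀, hx₀d⟩ : H) + (T† ⟨xp, hpd⟩ : H) + (T† ⟨xm, hmd⟩ : H) := by
    have e : (⟨x₀ + xp + xm, hsum_d⟩ : T†.domain) = ⟨x₀, hx₀d⟩ + ⟨xp, hpd⟩ + ⟨xm, hmd⟩ := rfl
    rw [e, LinearPMap.map_add, LinearPMap.map_add]
  rw [hlin, hTx₀, hpv, hmv] at hzero
  -- `(T x₀ + i x₀) + 2i xp = (T x₀ + i xp − i xm) + i (x₀ + xp + xm) = 0`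
  have key : subSMul T (-I) ⟨x₀, h₀⟩ + (2 * I) • xp = 0 := by
    rw [subSMul_apply]
    have h2 : I • (x₀ + xp + xm) = 0 := by rw [h, smul_zero]
    calc (T ⟨x₀, h₀⟩ : H) - (-I) • (x₀ : H) + (2 * I) • xp
        = ((T ⟨x₀, h₀⟩ : H) + I • xp + (-I) • xm) + I • (x₀ + xp + xm) := by module
      _ = 0 := by rw [hzero, h2, add_zero]
  -- orthogonality `Ran(T + i) ⊥ 𝒩₊` splits `key`
  set K : Submodule ℂ H := LinearMap.range (subSMul T (-I)) with hK
  have hv : subSMul T (-I) ⟨x₀, h₀⟩ ∈ K := LinearMap.mem_range_self _ _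
  have hw : (2 * I) • xp ∈ Kᗮ := by
    rw [hK, orthogonal_range_add_I_eq hd]; exact Submodule.smul_mem _ _ hp
  have hv' : subSMul T (-I) ⟨x₀, h₀⟩ ∈ Kᗮ := by
    have : subSMul T (-I) ⟨x₀, h₀⟩ = -((2 * I) • xp) := eq_neg_of_add_eq_zero_left key
    rw [this]; exact Submodule.neg_mem _ hw
  have hv0 : subSMul T (-I) ⟨x₀, h₀⟩ = 0 := by
    have : subSMul T (-I) ⟨x₀, h₀⟩ ∈ K ⊓ Kᗮ := ⟨hv, hv'⟩
    rwa [Submodule.inf_orthogonal_eq_bot, Submodule.mem_bot] at this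
  have hx₀0 : x₀ = 0 := by
    have hinj := subSMul_injective_of_isSymmetric hT (z := -I) (by simp)
    have : (⟨x₀, h₀⟩ : T.domain) = 0 := hinj (by rw [hv0, LinearMap.map_zero])
    exact congrArg Subtype.val this
  have hxp0 : xp = 0 := by
    rw [hv0, zero_add, smul_eq_zero] at key
    exact key.resolve_left (by norm_num)
  refine ⟨hx₀0, hxp0, ?_⟩
  rw [hx₀0, hxp0, zero_add, zero_add] at h
  exact h

/-- **Von Neumann's first formula** `dom T† = dom T ∔ 𝒩₊ ∔ 𝒩₋` as an identity of submodules of `H`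
(the sum is direct by `vonNeumann_decomposition_unique`). [cite: EdmundsEvans2018, Ch. III §4 Thm 4.5 (4.6)] -/
theorem adjoint_domain_eq_sup (hT : T.IsSymmetric) (hc : T.IsClosed) (hd : Dense (T.domain : Set H)) :
    T†.domain = T.domain ⊔ T†.eigenspace I ⊔ T†.eigenspace (-I) := by
  have hle : T ≤ T† := le_adjoint_of_isSymmetric hT hd
  apply le_antisymm
  · intro x hx
    obtain ⟨x₀, h₀, xp, hp, xm, hm, rfl⟩ := exists_vonNeumann_decomposition hT hc hd hx
    exact Submodule.add_mem _
      (Submodule.add_mem _ (Submodule.mem_sup_left (Submodule.mem_sup_left h₀))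
        (Submodule.mem_sup_left (Submodule.mem_sup_right hp)))
      (Submodule.mem_sup_right hm)
  · exact sup_le (sup_le hle.1 (LinearPMap.eigenspace_le_domain _ _)) (LinearPMap.eigenspace_le_domain _ _)

/-- The deficiency subspaces lie in `dom T†`. [cite: EdmundsEvans2018, Ch. III §4 Thm 4.5] -/
theorem eigenspace_adjoint_le_domain (z : ℂ) : T†.eigenspace z ≤ T†.domain :=
  LinearPMap.eigenspace_le_domain _ _

/-- **The complement of `dom T` in `dom T†` is `𝒩₊ × 𝒩₋`**: for a closed symmetric densely defined
`T`, `(x₊, x₋) ↦ [x₊ + x₋]` is a linear isomorphism from `𝒩₊ × 𝒩₋` onto the quotient of `dom T†` by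
(the copy inside it of) `dom T`. [cite: EdmundsEvans2018, Ch. III §4 Thm 4.5 (4.6)–(4.7)] -/
theorem nonempty_deficiency_prod_equiv_quotient (hT : T.IsSymmetric) (hc : T.IsClosed)
    (hd : Dense (T.domain : Set H)) :
    Nonempty ((↥(T†.eigenspace I) × ↥(T†.eigenspace (-I))) ≃ₗ[ℂ]
      (↥(T†.domain) ⧸ (T.domain.comap T†.domain.subtype))) := by
  set Dq : Submodule ℂ ↥(T†.domain) := T.domain.comap T†.domain.subtype with hDq
  set ι : (↥(T†.eigenspace I) × ↥(T†.eigenspace (-I))) →ₗ[ℂ] ↥(T†.domain) :=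
    (Submodule.inclusion (eigenspace_adjoint_le_domain (T := T) I)).comp (LinearMap.fst ℂ _ _) +
      (Submodule.inclusion (eigenspace_adjoint_le_domain (T := T) (-I))).comp (LinearMap.snd ℂ _ _)
    with hι
  have hι_apply : ∀ ab : ↥(T†.eigenspace I) × ↥(T†.eigenspace (-I)),
      ((ι ab : T†.domain) : H) = (ab.1 : H) + (ab.2 : H) := fun ab => rfl
  set Φ : (↥(T†.eigenspace I) × ↥(T†.eigenspace (-I))) →ₗ[ℂ] (↥(T†.domain) ⧸ Dq) := Dq.mkQ.comp ι
    with hΦ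
  have hinj : Function.Injective Φ := by
    rw [← LinearMap.ker_eq_bot, LinearMap.ker_eq_bot']
    rintro ⟨a, b⟩ hab
    rw [hΦ, LinearMap.comp_apply, Submodule.mkQ_apply, Submodule.Quotient.mk_eq_zero, hDq,
      Submodule.mem_comap, Submodule.subtype_apply, hι_apply] at hab
    have h := vonNeumann_decomposition_unique hT hd (Submodule.neg_mem _ hab) a.2 b.2 (by abel)
    exact Prod.ext (Subtype.ext h.2.1) (Subtype.ext h.2.2)
  have hsurj : Function.Surjective Φ := by
    intro q
    obtain ⟨w, rfl⟩ := Submodule.mkQ_surjective Dq q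
    obtain ⟨x₀, h₀, xp, hp, xm, hm, hw⟩ := exists_vonNeumann_decomposition hT hc hd w.2
    refine ⟨(⟨xp, hp⟩, ⟨xm, hm⟩), ?_⟩
    rw [hΦ, LinearMap.comp_apply, Submodule.mkQ_apply, Submodule.mkQ_apply, Submodule.Quotient.eq, hDq,
      Submodule.mem_comap]
    change (xp : H) + xm - (w : H) ∈ T.domain
    have : (xp : H) + xm - (w : H) = -x₀ := by rw [hw]; abel
    rw [this]
    exact Submodule.neg_mem _ h₀
  exact ⟨LinearEquiv.ofBijective Φ ⟨hinj, hsurj⟩⟩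

/-- **Von Neumann's dimension formula** `dim (dom T† / dom T) = m₊ + m₋` for a closed symmetric
densely defined `T` (with the convention `finrank = 0` for infinite-dimensional spaces the identity
needs the deficiency subspaces finite-dimensional). [cite: EdmundsEvans2018, Ch. III §4 Thm 4.5 (4.7)] -/
theorem finrank_adjoint_domain_quotient (hT : T.IsSymmetric) (hc : T.IsClosed)
    (hd : Dense (T.domain : Set H))
    [FiniteDimensional ℂ (T†.eigenspace I)] [FiniteDimensional ℂ (T†.eigenspace (-I))] :
    Module.finrank ℂ (↥(T†.domain) ⧸ (T.domain.comap T†.domain.subtype)) =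
      Module.finrank ℂ (T†.eigenspace I) + Module.finrank ℂ (T†.eigenspace (-I)) := by
  obtain ⟨e⟩ := nonempty_deficiency_prod_equiv_quotient hT hc hd
  rw [← e.finrank_eq, Module.finrank_prod]

/-- In particular `dom T† / dom T` is finite-dimensional when `𝒩±` are. [cite: EdmundsEvans2018, Ch. III §4 Thm 4.5 (4.7)] -/
theorem finiteDimensional_adjoint_domain_quotient (hT : T.IsSymmetric) (hc : T.IsClosed)
    (hd : Dense (T.domain : Set H))
    [FiniteDimensional ℂ (T†.eigenspace I)] [FiniteDimensional ℂ (T†.eigenspace (-I))] :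
    FiniteDimensional ℂ (↥(T†.domain) ⧸ (T.domain.comap T†.domain.subtype)) := by
  obtain ⟨e⟩ := nonempty_deficiency_prod_equiv_quotient hT hc hd
  exact Module.Finite.equiv e

/-! ### Adjoint of the closure; the formula for a symmetric operator and its closure -/

/-- `S ⊂ S'` with `dom S` dense implies `S'† ⊂ S†` (adjoints reverse extensions).
[cite: EdmundsEvans2018, Ch. III §4 ¶1] -/
theorem adjoint_le_adjoint_of_le {S S' : H →ₗ.[ℂ] H} (hS : Dense (S.domain : Set H)) (h : S ≤ S') :
    S'† ≤ S† := by
  have hS' : Dense (S'.domain : Set H) := hS.mono (fun x hx => h.1 hx)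
  refine IsFormalAdjoint.le_adjoint hS ?_
  intro x y
  -- `⟪S x, y⟫ = ⟪S' x, y⟫ = ⟪x, S'† y⟫`
  have hx' : (x : H) ∈ S'.domain := h.1 x.2
  have h1 : S' ⟨x, hx'⟩ = S x := (h.2 rfl).symm
  have h2 := adjoint_isFormalAdjoint hS' y ⟨x, hx'⟩
  -- h2 : ⟪S'† y, x⟫ = ⟪y, S' x⟫
  rw [h1] at h2
  rw [← inner_conj_symm, ← h2, inner_conj_symm]

/-- A densely defined symmetric operator is closable (it sits below the closed operator `T†`): "as the
adjoint is always closed, a symmetric operator is closable". [cite: EdmundsEvans2018, Ch. III §4 ¶1 (pdf p0120:L54)] -/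
theorem isClosable_of_isSymmetric (hT : T.IsSymmetric) (hd : Dense (T.domain : Set H)) :
    T.IsClosable :=
  (adjoint_isClosed hd).isClosable.leIsClosable (le_adjoint_of_isSymmetric hT hd)

/-- `T̄ ⊂ T†` for a densely defined symmetric `T`. [cite: EdmundsEvans2018, Ch. III §4 ¶1] -/
theorem closure_le_adjoint (hT : T.IsSymmetric) (hd : Dense (T.domain : Set H)) :
    T.closure ≤ T† := by
  have hcl := isClosable_of_isSymmetric hT hd
  refine LinearPMap.le_of_le_graph ?_
  rw [← hcl.graph_closure_eq_closure_graph]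
  exact (T.graph).topologicalClosure_minimal (LinearPMap.le_graph_of_le (le_adjoint_of_isSymmetric hT hd))
    (adjoint_isClosed hd)

/-- **The adjoint of the closure is the adjoint**: `T̄† = T†` for a densely defined closable `T`
(the adjoint only sees the closure of the graph). [cite: EdmundsEvans2018, Ch. III §4 ¶1 (with Thm 4.2 (ii) proof: `ℛ(T̄ − λ)` is the closure of `ℛ(T − λ)`)] -/
theorem adjoint_closure (hd : Dense (T.domain : Set H)) (hcl : T.IsClosable) : T.closure† = T† := by
  have hle : T ≤ T.closure := T.le_closure
  have hdc : Dense (T.closure.domain : Set H) := hd.mono (fun x hx => hle.1 hx)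
  apply le_antisymm (adjoint_le_adjoint_of_le hd hle)
  -- `T† ≤ T.closure†`: `⟪T.closure x̄, y⟫ = ⟪x̄, T† y⟫` by passing to the closure of the graph
  refine IsFormalAdjoint.le_adjoint hdc ?_
  intro xc y
  -- the closed set `{p | ⟪p.2, y⟫ = ⟪p.1, T† y⟫}` contains the graph of `T`, hence its closure
  set C : Set (H × H) := {p | ⟪p.2, (y : H)⟫_ℂ = ⟪p.1, (T† y : H)⟫_ℂ} with hC
  have hCc : IsClosed C :=
    isClosed_eq (continuous_snd.inner continuous_const) (continuous_fst.inner continuous_const)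
  have hTC : (T.graph : Set (H × H)) ⊆ C := by
    rintro p hp
    rw [SetLike.mem_coe, LinearPMap.mem_graph_iff] at hp
    obtain ⟨x, hx1, hx2⟩ := hp
    rw [hC, Set.mem_setOf_eq, ← hx1, ← hx2, ← inner_conj_symm, ← adjoint_isFormalAdjoint hd y x,
      inner_conj_symm]
  have hmem : ((xc : H), (T.closure xc : H)) ∈ C := by
    have hg : ((xc : H), (T.closure xc : H)) ∈ (T.closure.graph : Set (H × H)) :=
      (LinearPMap.mem_graph_iff _).2 ⟨xc, rfl, rfl⟩
    rw [← hcl.graph_closure_eq_closure_graph, Submodule.topologicalClosure_coe] at hg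
    exact closure_minimal hTC hCc hg
  simpa [hC] using hmem

/-- The closure of a densely defined symmetric operator is symmetric. [cite: EdmundsEvans2018, Ch. III §4 ¶1] -/
theorem isSymmetric_closure (hT : T.IsSymmetric) (hd : Dense (T.domain : Set H)) :
    T.closure.IsSymmetric := by
  have hcl := isClosable_of_isSymmetric hT hd
  have hle : T.closure ≤ T† := closure_le_adjoint hT hd
  have hdc : Dense (T.closure.domain : Set H) := hd.mono (fun x hx => T.le_closure.1 hx)
  intro x y
  -- `⟪T̄ x, y⟫ = ⟪T† x, y⟫ = ⟪x, T̄ y⟫` via `T̄† = T†`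
  have hx' : (x : H) ∈ T†.domain := hle.1 x.2
  have h1 : (T† ⟨x, hx'⟩ : H) = T.closure x := (hle.2 rfl).symm
  have hx'' : (x : H) ∈ T.closure†.domain := by rw [adjoint_closure hd hcl]; exact hx'
  have h2 : (T.closure† ⟨x, hx''⟩ : H) = T† ⟨x, hx'⟩ :=
    (le_of_eq (adjoint_closure hd hcl)).2 rfl
  have h3 := adjoint_isFormalAdjoint hdc ⟨x, hx''⟩ y
  -- h3 : ⟪T.closure† x, y⟫ = ⟪x, T.closure y⟫
  rw [h2, h1] at h3
  exact h3

/-- **Von Neumann's first formula for a symmetric operator and its closure**: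
`dom T† = dom T̄ ∔ 𝒩₊ ∔ 𝒩₋` for every densely defined symmetric `T` (apply the closed case to `T̄`,
whose adjoint is `T†`). This is the form used for `T` given on a core (e.g. `C_c^∞`), `T̄ = T_min`,
`T† = T_max`. [cite: EdmundsEvans2018, Ch. III §4 Thm 4.5 (4.6)] -/
theorem adjoint_domain_eq_closure_domain_sup (hT : T.IsSymmetric) (hd : Dense (T.domain : Set H)) :
    T†.domain = T.closure.domain ⊔ T†.eigenspace I ⊔ T†.eigenspace (-I) := by
  have hcl := isClosable_of_isSymmetric hT hd
  have hdc : Dense (T.closure.domain : Set H) := hd.mono (fun x hx => T.le_closure.1 hx)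
  have h := adjoint_domain_eq_sup (isSymmetric_closure hT hd) hcl.closure_isClosed hdc
  rwa [adjoint_closure hd hcl] at h

/-- Uniqueness half of von Neumann's formula in the closure form. [cite: EdmundsEvans2018, Ch. III §4 Thm 4.5 (4.6)] -/
theorem vonNeumann_decomposition_unique_closure (hT : T.IsSymmetric) (hd : Dense (T.domain : Set H))
    {x₀ xp xm : H} (h₀ : x₀ ∈ T.closure.domain) (hp : xp ∈ T†.eigenspace I)
    (hm : xm ∈ T†.eigenspace (-I)) (h : x₀ + xp + xm = 0) : x₀ = 0 ∧ xp = 0 ∧ xm = 0 := by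
  have hcl := isClosable_of_isSymmetric hT hd
  have hdc : Dense (T.closure.domain : Set H) := hd.mono (fun x hx => T.le_closure.1 hx)
  have hp' : xp ∈ T.closure†.eigenspace I := by rwa [adjoint_closure hd hcl]
  have hm' : xm ∈ T.closure†.eigenspace (-I) := by rwa [adjoint_closure hd hcl]
  exact vonNeumann_decomposition_unique (isSymmetric_closure hT hd) hdc h₀ hp' hm' h

/-- **`dim (dom T† / dom T̄) = m₊ + m₋`** for a densely defined symmetric `T` with finite deficiency
indices `m± = dim ker(T† ∓ i)`. [cite: EdmundsEvans2018, Ch. III §4 Thm 4.5 (4.7)] -/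
theorem finrank_adjoint_domain_quotient_closure (hT : T.IsSymmetric) (hd : Dense (T.domain : Set H))
    [FiniteDimensional ℂ (T†.eigenspace I)] [FiniteDimensional ℂ (T†.eigenspace (-I))] :
    Module.finrank ℂ (↥(T†.domain) ⧸ (T.closure.domain.comap T†.domain.subtype)) =
      Module.finrank ℂ (T†.eigenspace I) + Module.finrank ℂ (T†.eigenspace (-I)) := by
  have hcl := isClosable_of_isSymmetric hT hd
  have hdc : Dense (T.closure.domain : Set H) := hd.mono (fun x hx => T.le_closure.1 hx)
  have key := nonempty_deficiency_prod_equiv_quotient (isSymmetric_closure hT hd) hcl.closure_isClosed hdc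
  rw [adjoint_closure hd hcl] at key
  obtain ⟨e⟩ := key
  rw [← e.finrank_eq, Module.finrank_prod]

end Literature.Analysis.UnboundedOperators
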